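import Summits.CriticalPhenomena.PercolationContinuityZ3.Theorems.PercNearOneGluingNoHeavyLowerTailOneCutFivePocketUnionBound
import Mathlib.Tactic.Linarith
import Mathlib.Tactic.Positivity
import HarnessLib

/-!
# `NoHeavyLowerTail` (stmt-CriticalPhenomena-4575), |A| = 5 glued rung: `Z(3,2)` holds whenever ONE of the three
# connection events is independent of the other two (the "independent arm" sub-case)

builds on p205010 (kernel theorem, internal audit signed; external expert review pending)

Support file (prover seat `prim-quant-p1`, QUANT lane, LNT♯-EN layers; `--supports stmt-CriticalPhenomena-4575 --as helper`).
No definitions, no named facts, no sorries; standard axioms.  Memo: `run/shared/lean/prim/quant/P1-SURPLUS.md` §10.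

Setting: `μ = prodBernoulli w` on `Fin n`, observer `o`, three vertices `a, b, c`, `q_v = μ(o ↔ v)`, pocket `B = C_o ∩ {a,b,c}`.
`Z(3,2)` (`OneCutFive.ZeroOneThree`) is equivalent to the pocket exchange `μ(B = {a}) ≤ μ(B = {b,c})` at the weakest
vertex `a` under `q_a + q_b + q_c > 2` (`…OneCutFiveZeroOnePocket`); the tree has it when `q_a ≤ ½` and when
`q_b + q_c ≥ 1 + q_a` (`…OneCutFivePocketUnionBound`), and at one-layer observers (`…OneLayerTwoFinger*`).  This file adds the
structural sub-case in which one "arm" is probabilistically independent of the other two — e.g. when that vertex's component of the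
graph `G ∖ {o}` of positive-weight pairs contains neither of the other two vertices (then its connection event is determined by a
set of edges disjoint from the one determining the other two events).  It covers the equality family "independent arms of equal
weight" of the `Z(3,2)` census and every weighted star, but NOT the open core (all three vertices in one component of `G ∖ {o}`).

* `OneCutFive.pocketExchange_of_indep_weakest` — if `{o↔a}` is independent of `{o↔b}`, `{o↔c}` and `{o↔b} ∩ {o↔c}`
  (three product identities), `q_a ≤ q_b`, `q_a ≤ q_c` and `q_a + q_b + q_c > 2`, then `μ(B={a}) ≤ μ(B={b,c})`.
  Proof: the two cells factor as `q_a·μ(o↮b, o↮c)` and `(1−q_a)·μ(o↔b, o↔c)`; with `y = μ(o↔b, o↔c) ≤ min(q_b,q_c)` the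
  difference `(1−q_a)y − q_a(1 − q_b − q_c + y)` equals `y(1−2q_a) + q_a(q_b+q_c−1)` (both terms `≥ 0` if `q_a ≤ ½`) and
  `(q_b−y)(2q_a−1) + (q_b−q_a)(1−q_a) + q_a(q_c−q_a)` (all `≥ 0` if `q_a ≥ ½`).
* `OneCutFive.pocketExchange_of_indep_other` — the same conclusion if instead `{o↔b}` (NOT the weakest) is independent of
  `{o↔a}`, `{o↔c}`, `{o↔a} ∩ {o↔c}`: the cells are `(1−q_b)·μ(o↔a, o↮c)` and `q_b·μ(o↔c, o↮a)`, and `q_b ≥ ½`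
  (`2q_b ≥ q_a + q_b > 2 − q_c ≥ 1`), `μ(o↔a, o↮c) ≤ μ(o↔c, o↮a)` (`q_a ≤ q_c`).
* `OneCutFive.le_one_reached_le_of_indep_weakest` / `…_of_indep_other` — the `ZeroOneThree`-shaped conclusion
  `μ{o reaches ≤ 1 of {a,b,c}} ≤ t` for `t ≥ μ(o ↮ a)`, via the tree's `measureReal_le_one_le_compl_of_exchange`.
[cite: KozmaNitzan2024, Lemma 2 (p. 6) (level 1; the level-2 row `Z(3,2)` is this programme's)]
-/

noncomputable section

namespace Summit.CriticalPhenomena.PercolationContinuityZ3.Theorems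

open MeasureTheory Set Literature.Probability.LatticeModels Literature.Probability.Percolation
open scoped Classical BigOperators

namespace OneCutFive

variable {n : ℕ}

/-- `μ X = μ(X ∩ Y) + μ(X ∖ Y)` for the (discrete) product measure. [folklore] -/
private theorem real_split (μ : Measure (BondConfig (Fin n))) [IsProbabilityMeasure μ]
    (X Y : Set (BondConfig (Fin n))) : μ.real X = μ.real (X ∩ Y) + μ.real (X \ Y) :=
  (measureReal_inter_add_sdiff (μ := μ) (s := X) MeasurableSet.of_discrete).symm

/-- **Pocket exchange when the weakest arm is independent.**  If the event `{o↔a}` is independent of `{o↔b}`, of `{o↔c}`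
and of `{o↔b} ∩ {o↔c}`, `q_a ≤ q_b`, `q_a ≤ q_c` and `q_a + q_b + q_c > 2`, then `μ(B = {a}) ≤ μ(B = {b,c})`. [this work] -/
theorem pocketExchange_of_indep_weakest (w : Sym2 (Fin n) → unitInterval) (o a b c : Fin n)
    (hsum : 2 < (prodBernoulli w).real (openConn o a) + (prodBernoulli w).real (openConn o b) +
      (prodBernoulli w).real (openConn o c))
    (hab : (prodBernoulli w).real (openConn o a) ≤ (prodBernoulli w).real (openConn o b))
    (hac : (prodBernoulli w).real (openConn o a) ≤ (prodBernoulli w).real (openConn o c))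
    (hiB : (prodBernoulli w).real ((openConn o a : Set (BondConfig (Fin n))) ∩ openConn o b) =
      (prodBernoulli w).real (openConn o a) * (prodBernoulli w).real (openConn o b))
    (hiC : (prodBernoulli w).real ((openConn o a : Set (BondConfig (Fin n))) ∩ openConn o c) =
      (prodBernoulli w).real (openConn o a) * (prodBernoulli w).real (openConn o c))
    (hiBC : (prodBernoulli w).real ((openConn o a : Set (BondConfig (Fin n))) ∩ (openConn o b ∩ openConn o c)) =
      (prodBernoulli w).real (openConn o a) * (prodBernoulli w).real ((openConn o b : Set (BondConfig (Fin n))) ∩ openConn o c)) :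
    (prodBernoulli w).real {ω : BondConfig (Fin n) | ω ∈ openConn o a ∧ ω ∉ openConn o b ∧ ω ∉ openConn o c} ≤
      (prodBernoulli w).real {ω : BondConfig (Fin n) | ω ∉ openConn o a ∧ ω ∈ openConn o b ∧ ω ∈ openConn o c} := by
  set μ := prodBernoulli w with hμ
  set A : Set (BondConfig (Fin n)) := openConn o a with hA
  set B : Set (BondConfig (Fin n)) := openConn o b with hB
  set C : Set (BondConfig (Fin n)) := openConn o c with hC
  -- the cells as differences
  have hE1 : {ω : BondConfig (Fin n) | ω ∈ A ∧ ω ∉ B ∧ ω ∉ C} = (A \ B) \ C := by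
    ext ω; simp only [Set.mem_setOf_eq, Set.mem_sdiff]; tauto
  have hE3 : {ω : BondConfig (Fin n) | ω ∉ A ∧ ω ∈ B ∧ ω ∈ C} = (B ∩ C) \ A := by
    ext ω; simp only [Set.mem_setOf_eq, Set.mem_sdiff, Set.mem_inter_iff]; tauto
  -- bookkeeping
  have h1 : μ.real (A \ B) = μ.real A - μ.real (A ∩ B) := by
    have := real_split μ A B; linarith
  have h2 : μ.real ((A \ B) \ C) = μ.real (A \ B) - μ.real ((A \ B) ∩ C) := by
    have := real_split μ (A \ B) C; linarith
  have h3 : (A \ B) ∩ C = (A ∩ C) \ B := by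
    ext ω; simp only [Set.mem_inter_iff, Set.mem_sdiff]; tauto
  have h4 : μ.real ((A ∩ C) \ B) = μ.real (A ∩ C) - μ.real ((A ∩ C) ∩ B) := by
    have := real_split μ (A ∩ C) B; linarith
  have h5 : (A ∩ C) ∩ B = A ∩ (B ∩ C) := by
    ext ω; simp only [Set.mem_inter_iff]; tauto
  have h6 : μ.real ((B ∩ C) \ A) = μ.real (B ∩ C) - μ.real ((B ∩ C) ∩ A) := by
    have := real_split μ (B ∩ C) A; linarith
  have h7 : (B ∩ C) ∩ A = A ∩ (B ∩ C) := Set.inter_comm _ _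
  -- abbreviations
  set r := μ.real A with hr
  set pb := μ.real B with hpb
  set pc := μ.real C with hpc
  set y := μ.real (B ∩ C) with hy
  have hyb : y ≤ pb := measureReal_mono Set.inter_subset_left
  have hyc : y ≤ pc := measureReal_mono Set.inter_subset_right
  have hy0 : 0 ≤ y := measureReal_nonneg
  have hr0 : 0 ≤ r := measureReal_nonneg
  have hpc1 : pc ≤ 1 := measureReal_le_one
  have hcellA : μ.real {ω : BondConfig (Fin n) | ω ∈ A ∧ ω ∉ B ∧ ω ∉ C} = r * (1 - pb - pc + y) := by
    rw [hE1, h2, h1, h3, h4, h5, hiB, hiC, hiBC]; ring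
  have hcellBC : μ.real {ω : BondConfig (Fin n) | ω ∉ A ∧ ω ∈ B ∧ ω ∈ C} = (1 - r) * y := by
    rw [hE3, h6, h7, hiBC]; ring
  rw [hcellA, hcellBC]
  rcases le_or_gt r (1 / 2) with hle | hlt
  · -- `(1−r)y − r(1−pb−pc+y) = y(1−2r) + r(pb+pc−1)`, both terms `≥ 0`
    have t1 : 0 ≤ y * (1 - 2 * r) := mul_nonneg hy0 (by linarith)
    have t2 : 0 ≤ r * (pb + pc - 1) := mul_nonneg hr0 (by linarith)
    nlinarith [t1, t2]
  · -- `(1−r)y − r(1−pb−pc+y) = (pb−y)(2r−1) + (pb−r)(1−r) + r(pc−r)`, all terms `≥ 0`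
    have t1 : 0 ≤ (pb - y) * (2 * r - 1) := mul_nonneg (by linarith) (by linarith)
    have t2 : 0 ≤ (pb - r) * (1 - r) := mul_nonneg (by linarith) (by linarith [hac])
    have t3 : 0 ≤ r * (pc - r) := mul_nonneg hr0 (by linarith)
    nlinarith [t1, t2, t3]

/-- **Pocket exchange when another arm is independent.**  If `{o↔b}` is independent of `{o↔a}`, of `{o↔c}` and of
`{o↔a} ∩ {o↔c}`, `q_a ≤ q_b`, `q_a ≤ q_c` and `q_a + q_b + q_c > 2`, then `μ(B = {a}) ≤ μ(B = {b,c})`. [this work] -/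
theorem pocketExchange_of_indep_other (w : Sym2 (Fin n) → unitInterval) (o a b c : Fin n)
    (hsum : 2 < (prodBernoulli w).real (openConn o a) + (prodBernoulli w).real (openConn o b) +
      (prodBernoulli w).real (openConn o c))
    (hab : (prodBernoulli w).real (openConn o a) ≤ (prodBernoulli w).real (openConn o b))
    (hac : (prodBernoulli w).real (openConn o a) ≤ (prodBernoulli w).real (openConn o c))
    (hiA : (prodBernoulli w).real ((openConn o b : Set (BondConfig (Fin n))) ∩ openConn o a) =
      (prodBernoulli w).real (openConn o b) * (prodBernoulli w).real (openConn o a))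
    (hiC : (prodBernoulli w).real ((openConn o b : Set (BondConfig (Fin n))) ∩ openConn o c) =
      (prodBernoulli w).real (openConn o b) * (prodBernoulli w).real (openConn o c))
    (hiAC : (prodBernoulli w).real ((openConn o b : Set (BondConfig (Fin n))) ∩ (openConn o a ∩ openConn o c)) =
      (prodBernoulli w).real (openConn o b) * (prodBernoulli w).real ((openConn o a : Set (BondConfig (Fin n))) ∩ openConn o c)) :
    (prodBernoulli w).real {ω : BondConfig (Fin n) | ω ∈ openConn o a ∧ ω ∉ openConn o b ∧ ω ∉ openConn o c} ≤
      (prodBernoulli w).real {ω : BondConfig (Fin n) | ω ∉ openConn o a ∧ ω ∈ openConn o b ∧ ω ∈ openConn o c} := by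
  set μ := prodBernoulli w with hμ
  set A : Set (BondConfig (Fin n)) := openConn o a with hA
  set B : Set (BondConfig (Fin n)) := openConn o b with hB
  set C : Set (BondConfig (Fin n)) := openConn o c with hC
  have hE1 : {ω : BondConfig (Fin n) | ω ∈ A ∧ ω ∉ B ∧ ω ∉ C} = (A \ C) \ B := by
    ext ω; simp only [Set.mem_setOf_eq, Set.mem_sdiff]; tauto
  have hE3 : {ω : BondConfig (Fin n) | ω ∉ A ∧ ω ∈ B ∧ ω ∈ C} = (B ∩ C) \ A := by
    ext ω; simp only [Set.mem_setOf_eq, Set.mem_sdiff, Set.mem_inter_iff]; tauto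
  have h1 : μ.real (A \ C) = μ.real A - μ.real (A ∩ C) := by
    have := real_split μ A C; linarith
  have h2 : μ.real ((A \ C) \ B) = μ.real (A \ C) - μ.real ((A \ C) ∩ B) := by
    have := real_split μ (A \ C) B; linarith
  have h3 : (A \ C) ∩ B = (B ∩ A) \ C := by
    ext ω; simp only [Set.mem_inter_iff, Set.mem_sdiff]; tauto
  have h4 : μ.real ((B ∩ A) \ C) = μ.real (B ∩ A) - μ.real ((B ∩ A) ∩ C) := by
    have := real_split μ (B ∩ A) C; linarith
  have h5 : (B ∩ A) ∩ C = B ∩ (A ∩ C) := Set.inter_assoc _ _ _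
  have h6 : μ.real ((B ∩ C) \ A) = μ.real (B ∩ C) - μ.real ((B ∩ C) ∩ A) := by
    have := real_split μ (B ∩ C) A; linarith
  have h7 : (B ∩ C) ∩ A = B ∩ (A ∩ C) := by
    ext ω; simp only [Set.mem_inter_iff]; tauto
  set pa := μ.real A with hpa
  set pb := μ.real B with hpb
  set pc := μ.real C with hpc
  set z := μ.real (A ∩ C) with hz
  have hza : z ≤ pa := measureReal_mono Set.inter_subset_left
  have hpc1 : pc ≤ 1 := measureReal_le_one
  have hcellA : μ.real {ω : BondConfig (Fin n) | ω ∈ A ∧ ω ∉ B ∧ ω ∉ C} = (1 - pb) * (pa - z) := by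
    rw [hE1, h2, h1, h3, h4, h5, hiA, hiAC]; ring
  have hcellBC : μ.real {ω : BondConfig (Fin n) | ω ∉ A ∧ ω ∈ B ∧ ω ∈ C} = pb * (pc - z) := by
    rw [hE3, h6, h7, hiC, hiAC]; ring
  rw [hcellA, hcellBC]
  -- `pb(pc−z) − (1−pb)(pa−z) = pb(pc−pa) + (2pb−1)(pa−z)`, both `≥ 0` (`pb ≥ ½` from `2 pb ≥ pa + pb > 2 − pc ≥ 1`)
  have hb2 : 1 ≤ 2 * pb := by linarith
  have t1 : 0 ≤ pb * (pc - pa) := mul_nonneg (by linarith [measureReal_nonneg (μ := μ) (s := A)]) (by linarith)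
  have t2 : 0 ≤ (2 * pb - 1) * (pa - z) := mul_nonneg (by linarith) (by linarith)
  nlinarith [t1, t2]

/-- **`Z(3,2)` with an independent weakest arm**: under the hypotheses of `pocketExchange_of_indep_weakest`, for `R = {a,b,c}`
(distinct) and every `t ≥ μ(o ↮ a)`: `μ{o reaches at most one vertex of R} ≤ t`. [this work] -/
theorem le_one_reached_le_of_indep_weakest (w : Sym2 (Fin n) → unitInterval) (R : Finset (Fin n)) (o a b c : Fin n) (t : ℝ)
    (hR : R = {a, b, c}) (hab' : a ≠ b) (hac' : a ≠ c) (hbc' : b ≠ c)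
    (hsum : 2 < (prodBernoulli w).real (openConn o a) + (prodBernoulli w).real (openConn o b) +
      (prodBernoulli w).real (openConn o c))
    (hab : (prodBernoulli w).real (openConn o a) ≤ (prodBernoulli w).real (openConn o b))
    (hac : (prodBernoulli w).real (openConn o a) ≤ (prodBernoulli w).real (openConn o c))
    (hiB : (prodBernoulli w).real ((openConn o a : Set (BondConfig (Fin n))) ∩ openConn o b) =
      (prodBernoulli w).real (openConn o a) * (prodBernoulli w).real (openConn o b))
    (hiC : (prodBernoulli w).real ((openConn o a : Set (BondConfig (Fin n))) ∩ openConn o c) =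
      (prodBernoulli w).real (openConn o a) * (prodBernoulli w).real (openConn o c))
    (hiBC : (prodBernoulli w).real ((openConn o a : Set (BondConfig (Fin n))) ∩ (openConn o b ∩ openConn o c)) =
      (prodBernoulli w).real (openConn o a) * (prodBernoulli w).real ((openConn o b : Set (BondConfig (Fin n))) ∩ openConn o c))
    (ht : (prodBernoulli w).real (openConn o a)ᶜ ≤ t) :
    (prodBernoulli w).real {ω : BondConfig (Fin n) | (R.filter fun v => ω ∈ openConn o v).card ≤ 1} ≤ t := by
  have hP := pocketExchange_of_indep_weakest w o a b c hsum hab hac hiB hiC hiBC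
  have ha : a ∈ R := by simp [hR]
  have hb : b ∈ R := by simp [hR]
  have hc : c ∈ R := by simp [hR]
  exact (measureReal_le_one_le_compl_of_exchange w R o a b c ha hb hc hab' hac' hbc' hP).trans ht

/-- **`Z(3,2)` with an independent non-weakest arm**: under the hypotheses of `pocketExchange_of_indep_other`, for
`R = {a,b,c}` (distinct) and every `t ≥ μ(o ↮ a)`: `μ{o reaches at most one vertex of R} ≤ t`. [this work] -/
theorem le_one_reached_le_of_indep_other (w : Sym2 (Fin n) → unitInterval) (R : Finset (Fin n)) (o a b c : Fin n) (t : ℝ)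
    (hR : R = {a, b, c}) (hab' : a ≠ b) (hac' : a ≠ c) (hbc' : b ≠ c)
    (hsum : 2 < (prodBernoulli w).real (openConn o a) + (prodBernoulli w).real (openConn o b) +
      (prodBernoulli w).real (openConn o c))
    (hab : (prodBernoulli w).real (openConn o a) ≤ (prodBernoulli w).real (openConn o b))
    (hac : (prodBernoulli w).real (openConn o a) ≤ (prodBernoulli w).real (openConn o c))
    (hiA : (prodBernoulli w).real ((openConn o b : Set (BondConfig (Fin n))) ∩ openConn o a) =
      (prodBernoulli w).real (openConn o b) * (prodBernoulli w).real (openConn o a))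
    (hiC : (prodBernoulli w).real ((openConn o b : Set (BondConfig (Fin n))) ∩ openConn o c) =
      (prodBernoulli w).real (openConn o b) * (prodBernoulli w).real (openConn o c))
    (hiAC : (prodBernoulli w).real ((openConn o b : Set (BondConfig (Fin n))) ∩ (openConn o a ∩ openConn o c)) =
      (prodBernoulli w).real (openConn o b) * (prodBernoulli w).real ((openConn o a : Set (BondConfig (Fin n))) ∩ openConn o c))
    (ht : (prodBernoulli w).real (openConn o a)ᶜ ≤ t) :
    (prodBernoulli w).real {ω : BondConfig (Fin n) | (R.filter fun v => ω ∈ openConn o v).card ≤ 1} ≤ t := by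
  have hP := pocketExchange_of_indep_other w o a b c hsum hab hac hiA hiC hiAC
  have ha : a ∈ R := by simp [hR]
  have hb : b ∈ R := by simp [hR]
  have hc : c ∈ R := by simp [hR]
  exact (measureReal_le_one_le_compl_of_exchange w R o a b c ha hb hc hab' hac' hbc' hP).trans ht

end OneCutFive

end Summit.CriticalPhenomena.PercolationContinuityZ3.Theorems

end
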